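import Summits.ResolutionOfSingularities.ResolutionOfSingularities.Theorems.HilbertSamuelEliminationSigmaMaxModificationsCorridor3WLadderIsoTowerQuadraticTransforms
import Summits.ResolutionOfSingularities.ResolutionOfSingularities.Theorems.HilbertSamuelEliminationSigmaMaxModificationsCorridor3WLadderIsoKernelCPFrame
import Summits.ResolutionOfSingularities.ResolutionOfSingularities.Theorems.HilbertSamuelEliminationSigmaMaxModificationsCorridor3WLadderIsoKernelHSIsolatedStalk
import Literature.AlgebraicGeometry.Resolution.HilbertSamuelLocal
import HarnessLib

/-!
# [OURS · L1 W4.2] THE ISO-KERNEL SLICE IN COSSART–PILTANT'S FRAME, SCHEME FORM: no isolated E3 point tower (read in one field with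
# compatible stalk embeddings) over a `p`-cyclic threefold hypersurface germ — MODULO the printed Cossart–Piltant 2019 Thm. 1.5
# (step 3 of the scheme ↔ ring dictionary: assembly)

Crux chain w42 (`SigmaMaxModifications`, stmt-ResolutionOfSingularities-18506; conjunct `SigmaMaxModificationsCorridor3`, stmt-…-19249),
line `w_ladder`, registered stubs `stub_isoInsepTower` / `stub_isoSepRecurrent` of skeleton v8.6 (the residual of the isolated kernel
`IsoQuadraticTowerTerminates p 3`). Lead res-L1-w42-lead-1 (gen 5). Helper file `--supports stmt-ResolutionOfSingularities-19249`; kernel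
only (no definition, no new named fact; CONDITIONAL on the Literature named fact `CossartPiltant2019LocalPermissible` taken as a hypothesis).

WHAT IS PROVED (`false_of_isIsoPointTower_of_stalk_embeddings_of_CP`). Data: Cossart–Piltant's frame VERBATIM (`p`-cyclic hypersurface germ
`R[x] ⊂ L`, `R` excellent regular local of dimension `3`, residue characteristic `p`, (MIN), (GEN), case (i)/(ii)); an isolated E3 point tower
`IsIsoPointTower N ν T pt` (res-type-012) with integral stages; a COMPATIBLE FAMILY OF INJECTIVE STALK EMBEDDINGS `θ n : 𝒪_{X_n, pt n} ↪ L`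
(`θ (n+1) ∘ π_n^♯ = θ n`); the origin germ IS CP's germ (`R ⊆ θ₀(𝒪_{X_0,pt 0})` dominated, and for every valuation ring `O` dominating
`θ₀(𝒪_{X_0,pt 0})` that image is the local ring `(R[x])_{𝔪_O ∩ R[x]}` of `𝒳` at the centre of `O`); every stage SINGULAR at the marked point;
with catenary stalks at the marked points (excellence) and `ψ_{X_n}(pt n) ≤ N`. Conclusion: `False`. The HS-isolation clause of `IsIsoPointTower`
(`IsIsolatedInHSMaxLocus`) is read on the stalk by `hsIsolated_stalk_of_isIsolatedInHSMaxLocus` (`…IsoKernelHSIsolatedStalk`). Proof: step 2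
(`exists_valuation_forall_isQuadraticTransformAlong_of_isIsoPointTower`, p551840) reads the tower as a tower of quadratic transforms along a
Chevalley valuation ring `O`; the stalk hypotheses are transported to the images along `𝒪_{X_n,pt n} ≃ θ_n(𝒪_{X_n,pt n})` (§1); then
`false_of_hsIsolated_singular_pointTower_of_CP` (p547474: Cossart–Piltant's permissible tower IS this tower, and reaches a regular member).

WHAT IS LEFT to a consumer of the registered rows (honest): (a) producing the embeddings `θ n` and the origin presentation from a concrete
`X_0 = Spec R[x]` (routine: `IsBlowup.stalkEmb` + function-field identifications); (b) catenarity of the stalks (excellence of the stages: `Scheme.isCatenaryRing_stalk_of_isExcellent`), `ψ ≤ N` (`Scheme.hsPsi_le` with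
`dim ≤ N`) and singularity from `ν ≠ Φ^{(N)}` (`Scheme.hsFun_eq_iterPSum_Phi_iff`); (c) the frame itself: only `p`-cyclic hypersurface
germs of embedding dimension `4` are covered by print (CP p. 3).

HONEST FRAMING. OURS bookkeeping; nothing here is a statement of H. Hironaka's manuscript [Hironaka2017] nor a new claim about
[CossartPiltant2019] / [CossartJannsenSaito2020]. AI-written; AI review is weaker than expert review.

References: V. Cossart, O. Piltant, J. Algebra 529 (2019), Thm. 1.5 (arXiv v1 Thm. 1.4), Def. 2.20–2.21, p. 3 [CossartPiltant2019];
The Stacks Project, Tag 0804 [StacksProject]; S. D. Cutkosky (2014) §2.2 [Cutkosky2014]; V. Cossart, U. Jannsen, S. Saito, LNM 2270 (2020),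
Thm. 3.3, Def. 6.38 [CossartJannsenSaito2020].
-/

noncomputable section

set_option linter.dupNamespace false

open Polynomial IsLocalRing AlgebraicGeometry CategoryTheory
open Literature.AlgebraicGeometry.Resolution Literature.AlgebraicGeometry.CossartJannsenSaito2020 Literature.RingTheory.HilbertSamuel
open Summit.ResolutionOfSingularities.ResolutionOfSingularities.Cruxes.SigmaMaxModifications.IdeasL1Idea2R4 (IsIsoPointTower)

namespace Summit.ResolutionOfSingularities.ResolutionOfSingularities.Cruxes.SigmaMaxModifications.IdeasL1C5

universe u

/-! ## §1. Transport of the stalk hypotheses to the image subring along `𝒪 ≃ θ(𝒪)` -/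

section Transport

variable {L : Type u} [Field L] {A : Type u} [CommRing A] (θ : A →+* L) (hθ : Function.Injective θ)

include hθ in
/-- The image of a Noetherian ring under an injective map is Noetherian (`A ≃ θ(A)`). [folklore] -/
theorem isNoetherianRing_range [IsNoetherianRing A] : IsNoetherianRing θ.range :=
  isNoetherianRing_of_ringEquiv A
    (RingEquiv.ofBijective θ.rangeRestrict ⟨fun _ _ h => hθ (congrArg Subtype.val h), θ.rangeRestrict_surjective⟩)

include hθ in
/-- Regularity of the image implies regularity of the source. [folklore] -/
theorem not_isRegularLocalRing_range (hsing : ¬ IsRegularLocalRing A) [IsLocalRing θ.range] : ¬ IsRegularLocalRing θ.range :=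
  fun h => hsing (@IsRegularLocalRing.of_ringEquiv _ _ h _ _
    (RingEquiv.ofBijective θ.rangeRestrict ⟨fun _ _ h => hθ (congrArg Subtype.val h), θ.rangeRestrict_surjective⟩).symm)

variable [IsLocalRing A] [IsNoetherianRing A]

include hθ in
/-- **HS-isolation among generizations transports to the image**: if `H^{(dim A/Q₀)}(A_{Q₀}) ≠ H^{(0)}(A)` for every prime `Q₀ ≠ 𝔪_A` with
regular quotient, then the same holds for the image subring `θ(A) ≅ A`. [folklore] -/
theorem hsIsolated_range
    (hiso : ∀ (Q : Ideal A) (_ : Q.IsPrime), Q ≠ maximalIdeal A → IsRegularLocalRing (A ⧸ Q) →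
      ∀ r : ℕ, ringKrullDim (A ⧸ Q) = r → hilbertSamuelFun (Localization.AtPrime Q) r ≠ hilbertFun A)
    (hC : IsLocalRing θ.range) (Q : Ideal θ.range) (hQ : Q.IsPrime) (hne : Q ≠ maximalIdeal θ.range)
    (hreg : IsRegularLocalRing (θ.range ⧸ Q)) (r : ℕ) (hr : ringKrullDim (θ.range ⧸ Q) = r) :
    hilbertSamuelFun (Localization.AtPrime Q) r ≠ hilbertFun θ.range := by
  let e : A ≃+* θ.range :=
    RingEquiv.ofBijective θ.rangeRestrict ⟨fun _ _ h => hθ (congrArg Subtype.val h), θ.rangeRestrict_surjective⟩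
  set Q₀ : Ideal A := Q.comap (e : A →+* θ.range) with hQ₀
  haveI : Q₀.IsPrime := Ideal.IsPrime.comap _
  have hmap : Q = Q₀.map (e : A →+* θ.range) :=
    (Ideal.map_comap_of_surjective (e : A →+* θ.range) e.surjective Q).symm
  have hmemQ₀ : ∀ a, a ∈ Q₀ ↔ e a ∈ Q := fun a => Ideal.mem_comap
  -- `Q₀ ≠ 𝔪_A`
  have hne₀ : Q₀ ≠ maximalIdeal A := by
    intro h0
    apply hne
    rw [hmap, h0]
    exact IsLocalRing.map_ringEquiv_maximalIdeal e
  -- quotients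
  let eq : A ⧸ Q₀ ≃+* θ.range ⧸ Q := Ideal.quotientEquiv Q₀ Q e hmap
  haveI : IsRegularLocalRing (A ⧸ Q₀) := IsRegularLocalRing.of_ringEquiv eq.symm
  have hr₀ : ringKrullDim (A ⧸ Q₀) = r := by rw [ringKrullDim_eq_of_ringEquiv eq, hr]
  -- localizations
  have hM : Q₀.primeCompl.map e.toMonoidHom = Q.primeCompl := by
    ext c
    simp only [Submonoid.mem_map, Ideal.mem_primeCompl_iff]
    constructor
    · rintro ⟨a, ha, rfl⟩
      exact fun hc => ha ((hmemQ₀ a).mpr hc)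
    · intro hc
      refine ⟨e.symm c, fun h0 => hc ?_, ?_⟩
      · have := (hmemQ₀ _).mp h0
        simpa using this
      · simp
  let eL : Localization.AtPrime Q₀ ≃+* Localization.AtPrime Q :=
    IsLocalization.ringEquivOfRingEquiv (Localization.AtPrime Q₀) (Localization.AtPrime Q) e hM
  have h1 : hilbertSamuelFun (Localization.AtPrime Q₀) r = hilbertSamuelFun (Localization.AtPrime Q) r :=
    hilbertSamuelFun_eq_of_ringEquiv eL r
  have h2 : hilbertFun A = hilbertFun θ.range := hilbertFun_eq_of_ringEquiv e
  rw [← h1, ← h2]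
  exact hiso Q₀ inferInstance hne₀ inferInstance r hr₀

end Transport

/-! ## §2. The slice: no isolated point tower over a `p`-cyclic threefold hypersurface germ, modulo the printed Cossart–Piltant Thm. 1.5 -/

section Slice

variable {L : Type u} [Field L]

/-- **THE ISO-KERNEL SLICE, SCHEME FORM (modulo print).** In Cossart–Piltant's frame, an isolated E3 point tower with integral stages, read
in `L` by compatible injective stalk embeddings whose origin image is CP's germ at the centre of every dominating valuation, SINGULAR and
HS-ISOLATED AMONG GENERIZATIONS at every marked point, does not exist. CONDITIONAL on `CossartPiltant2019LocalPermissible`.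
[cite: CossartPiltant2019, Thm. 1.5 (arXiv v1: Thm. 1.4), Def. 2.20–2.21] [cite: CossartJannsenSaito2020, Thm. 3.3, Def. 6.38] [cite: Cutkosky2014, §2.2] -/
theorem false_of_isIsoPointTower_of_stalk_embeddings_of_CP (hCP : CossartPiltant2019LocalPermissible.{u})
    (p : ℕ) (hp : p.Prime) (R : Subring L) [IsRegularLocalRing R]
    (hexc : IsExcellentRing R) (hdim : ringKrullDim R = 3) (hchar : CharP (ResidueField R) p)
    (h : R[X]) (x : L) (hmon : h.Monic) (hdeg : h.natDegree = p) (hx : aeval x h = 0)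
    (hmin : ∀ g : R[X], g.natDegree < p → aeval x g = 0 → g = 0)
    (hgen : ∀ z : L, ∃ (g : R[X]) (s : R), s ≠ 0 ∧ z * s = aeval x g)
    (hcase : (CharP L p ∧ ∀ i, 0 < i → i < p → h.coeff i = 0) ∨
      (Nat.card (L ≃ₐ[R] L) = p ∧
        ∀ σ : L ≃ₐ[R] L, ∀ y ∈ Algebra.adjoin R ({x} : Set L), σ y ∈ Algebra.adjoin R ({x} : Set L)))
    -- the isolated point tower, read in `L`
    {N : ℕ} {ν : ℕ → ℕ} {T : BlowupTower.{u}} {pt : ∀ n, T.X n} (hT : IsIsoPointTower N ν T pt)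
    (hint : ∀ n, IsIntegral (T.X n))
    (θ : ∀ n, (T.X n).presheaf.stalk (pt n) →+* L) (hinj : ∀ n, Function.Injective (θ n))
    (hcomp : ∀ n, (θ (n + 1)).comp ((T.π n).stalkMap (pt (n + 1))).hom =
      (θ n).comp ((T.X n).presheaf.stalkCongr (.of_eq (hT.2.1 n))).hom.hom)
    -- the origin germ is Cossart–Piltant's germ
    (hR0 : R ≤ (θ 0).range) (hRdom : SubringDominates R (θ 0).range)
    (horigin : ∀ O : ValuationSubring L, SubringDominates (θ 0).range O.toSubring →
      (θ 0).range = locAtCentre (Algebra.adjoin R ({x} : Set L)).toSubring O)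
    -- singular marked points with catenary stalks, level `N ≥ ψ`
    (hsing : ∀ n, ¬ IsRegularLocalRing ((T.X n).presheaf.stalk (pt n)))
    (hcat : ∀ n, IsCatenaryRing ((T.X n).presheaf.stalk (pt n)))
    (hN : ∀ n, Scheme.hsPsi (T.X n) (pt n) ≤ N) :
    False := by
  -- the stalk form of HS-isolation, from `IsIsolatedInHSMaxLocus` (clause of `IsIsoPointTower`)
  have hiso : ∀ n (Q : Ideal ((T.X n).presheaf.stalk (pt n))) (_ : Q.IsPrime), Q ≠ maximalIdeal _ →
      IsRegularLocalRing (((T.X n).presheaf.stalk (pt n)) ⧸ Q) →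
      ∀ r : ℕ, ringKrullDim (((T.X n).presheaf.stalk (pt n)) ⧸ Q) = r →
        hilbertSamuelFun (Localization.AtPrime Q) r ≠ hilbertFun ((T.X n).presheaf.stalk (pt n)) := by
    intro n Q hQ hne hreg r hr
    haveI := T.ln n
    haveI := hreg
    exact hsIsolated_stalk_of_isIsolatedInHSMaxLocus N (pt n) (hT.2.2.2.2.1 n) (hcat n) (hN n) Q hne r hr
  obtain ⟨O, hdomO, hqt⟩ := exists_valuation_forall_isQuadraticTransformAlong_of_isIsoPointTower hT hint θ hinj hcomp
  -- Cossart–Piltant's domination data for `R`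
  have hRO : R ≤ O.toSubring := hR0.trans (hdomO 0).1
  have hRdomO : SubringDominates R O.toSubring := hRdom.trans (hdomO 0)
  have hdom : ∀ r : R, r ∈ maximalIdeal R → O.valuation (r : L) < 1 :=
    fun r hr => ((subringDominates_valuationSubring_iff hRO).mp hRdomO r).mp hr
  refine false_of_hsIsolated_singular_pointTower_of_CP hCP p hp R hexc hdim hchar h x hmon hdeg hx hmin hgen hcase O hRO hdom
    (fun n => (θ n).range) (horigin O (hdomO 0)) hqt (fun n => ?_) (fun n C hC hCl Q hQ hne hreg r hr => ?_) (fun n => ?_)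
  · haveI := T.ln n
    exact isNoetherianRing_range (θ n) (hinj n)
  · subst hC
    haveI := T.ln n
    exact hsIsolated_range (θ n) (hinj n) (hiso n) hCl Q hQ hne hreg r hr
  · haveI := T.ln n
    haveI : IsLocalRing (θ n).range := isLocalRing_of_range_eq (θ n) _ rfl
    exact not_isRegularLocalRing_range (θ n) (hinj n) (hsing n)

end Slice

end Summit.ResolutionOfSingularities.ResolutionOfSingularities.Cruxes.SigmaMaxModifications.IdeasL1C5

end
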